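import Literature.AlgebraicGeometry.Frobenioids.CategoriesFactorization
import Literature.AlgebraicGeometry.Frobenioids.ElementaryFrobenioid
import Literature.AlgebraicGeometry.Frobenioids.ModelFrobenioid
import Literature.AlgebraicGeometry.Frobenioids.ModelFrobenioidFunctor
import Literature.AlgebraicGeometry.Frobenioids.PreFrobenioidDataOfFunctor
import Literature.AlgebraicGeometry.Frobenioids.BaseCategoryTheoreticityDefs
import Literature.AlgebraicGeometry.Frobenioids.DivisorMonoidCategoryTheoreticityDefs
import HarnessLib

/-!
# Frobenioids I, §5: model Frobenioids — rational functions and standard type (Thm. 5.2 (ii)b, (iii))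

Mochizuki, *The geometry of Frobenioids I*, Kyushu J. Math. **62** (2008), §5, Theorem 5.2, kurims
p. 101 [cite: MochizukiFrdI2008, Thm. 5.2(ii) p.101].  The category of Thm. 5.2 (i) is
`ModelFrobenioid Φ B DivB` with its pre-Frobenioid structure `ModelFrobenioid.toElem`
(`ModelFrobenioid.lean`, `ModelFrobenioidFunctor.lean`); "is a Frobenioid of isotropic and model type"
((ii) first sentence) and (iv) are typed by other seats (abc-iut-found, abc-iut-L6-t8).  Here:

* **(ii), "Moreover"** (`O^×(−)` of `C^birat ≅ B`): recorded as a documentation item only (see the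
  comment block below) — its honest statement needs the concrete `C^birat` of seat L1-t5 (ruling C5);
  the object-wise form is explicit in `ModelFrobenioidUnits.lean`.
* **(iii)**: "`C` is of standard type iff (a) if `Φ` is the zero monoid, then `C` admits a
  Frobenius-compact object; (b) `D` is of FSMFF-type; (c) `Φ` is non-dilating" — CONCRETE statement
  through seat L1-t3's `PreFrobenioidData.IsOfStandardType` / `IsFrobeniusCompact` applied to
  `PreFrobenioidData.ofFunctor Φ (toElem Φ B DivB)`; "`C` is of rationally standard type iff (a) `C` is
  of rational and standard type; (b) `(C^un-tr)^birat` admits a Frobenius-compact object" — statement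
  with the Def. 4.5 (ii)(iii) predicates and `(C^un-tr)^birat` as named `Prop` parameters (L1-t3's
  `IsOfRationallyStandardType` takes the §2/§4 data as parameters; TODO-merge).
-/

noncomputable section

namespace Literature.AlgebraicGeometry.Frobenioids

open CategoryTheory Opposite

universe w v u

namespace ModelFrobenioid

variable {D : Type u} [Category.{v} D] (Φ B : Dᵒᵖ ⥤ CommMonCat.{w}) (DivB : B ⟶ monoidGp Φ)

/-- The standing hypotheses of Thm. 5.2: `Φ` a divisorial monoid on a connected, totally epimorphic
category `D`, `B` a group-like monoid on `D`. [cite: MochizukiFrdI2008, Thm. 5.2 p.100] -/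
structure Hypotheses : Prop where
  /-- `Φ` is a monoid on `D` … -/
  isMonoidOn : IsMonoidOn Φ
  /-- … and divisorial -/
  isDivisorial : Objectwise (fun M _ => IsDivisorial M) Φ
  /-- `B` is a monoid on `D` … -/
  isMonoidOn_rat : IsMonoidOn B
  /-- … and group-like -/
  isGroupLike_rat : Objectwise (fun M _ => IsGroupLike M) B
  /-- `D` is connected -/
  isGraphConnected : IsGraphConnected D
  /-- `D` is totally epimorphic -/
  isTotallyEpimorphic : IsTotallyEpimorphic D

/-- The pre-Frobenioid data `(Base, Div, deg_Fr)` of the model Frobenioid in seat L1-t3's packaging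
(`PreFrobenioidData.ofFunctor` of `toElem`), through which the §3 type predicates apply.
[cite: MochizukiFrdI2008, Thm. 5.2(iii) p.101] -/
abbrev data : PreFrobenioidData.{w} (ModelFrobenioid Φ B DivB) D :=
  PreFrobenioidData.ofFunctor Φ (toElem Φ B DivB)

/-! ### Theorem 5.2 (ii), "Moreover" -/

/- **Thm. 5.2 (ii)**, "Moreover": "there is a natural isomorphism of functors between the functor
`O^×(−)` on `D` associated to the Frobenioid `C^birat` [cf. Propositions 2.2, (ii), (iii); 4.4, (ii)]
and the functor `B`; this isomorphism is compatible with the homomorphisms `O^×(−) → Φ^gp`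
[cf. Proposition 4.4, (iii)], `Div_B : B → Φ^gp`."  NOT typed as a closed statement here: it quotes
the rational-function functor of `C^birat`, whose concrete construction for a general Frobenioid is
seat L1-t5's (ruling C5); a statement over an *arbitrary* functor parameter would be false as typed.
The object-wise content — `O^×((A_D, α)) ↪ B(A_D)` compatibly with `Div_B` — is explicit in
`ModelFrobenioidUnits.lean` (`unitsToRatFn`, `divB_unitsToRatFn`).  TODO-merge: state the functor-level
isomorphism over L1-t5's `C^birat` once it lands. [cite: MochizukiFrdI2008, Thm. 5.2(ii) p.101] -/

/-! ### Theorem 5.2 (iii) -/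

/-- "`Φ` is the zero monoid" (Thm. 5.2 (iii)(a)). [cite: MochizukiFrdI2008, Thm. 5.2(iii) p.101] -/
def IsZeroMonoid : Prop := ∀ (A : Dᵒᵖ) (x : Φ.obj A), x = 1

/-- **Thm. 5.2 (iii)**, first sentence (statement): "`C` is of standard type if and only if the
following conditions are satisfied: (a) if `Φ` is the zero monoid, then `C` admits a Frobenius-compact
object; (b) `D` is of FSMFF-type; (c) `Φ` is non-dilating" — with *standard type* (Def. 3.1 (i)) and
*Frobenius-compact* (Def. 1.2 (iv)) as typed by seat L1-t3 (`PreFrobenioidData.IsOfStandardType`,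
`IsFrobeniusCompact`) for the data of the model Frobenioid. [cite: MochizukiFrdI2008, Thm. 5.2(iii) p.101] -/
def StandardTypeIff : Prop :=
  Hypotheses Φ B →
    ((data Φ B DivB).IsOfStandardType ↔
      (IsZeroMonoid Φ → ∃ X : ModelFrobenioid Φ B DivB, (data Φ B DivB).IsFrobeniusCompact X) ∧
        IsOfFSMFFType D ∧ IsNonDilatingOn Φ)

/-- **Thm. 5.2 (iii)**, second sentence (statement): "`C` is of rationally standard type if and only if
the following conditions are satisfied: (a) `C` is of rational and standard type; (b)
`(C^un-tr)^birat` admits a Frobenius-compact object."  *Rationally standard* / *rational* type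
(Def. 4.5 (ii)(iii)) and the category `(C^un-tr)^birat` with its Frobenius-compactness predicate are
named parameters (seat L1-t3's `IsOfRationallyStandardType` is itself parametrised by the §2/§4 data).

**SCHEMA** in `IsOfRationallyStandardType` / `IsOfRationalType` / `CunTrBirat`, `IsFrobeniusCompactIn`
(ruling W2-8 (3)+(5), finding RQ7-L1t2-F5): this declaration is faithful to print ONLY when
instantiated with THE constructions — closed instantiation = seat L1-t3's Defs4
`(data Φ B DivB).RSParams` / `PreFrobenioidData.IsOfRationallyStandardType S R` / `R.BU.Birat`,
`IsFrobeniusCompact` (and seat L1-t5's `C^birat`, ruling C5); with junk arguments it is NOT a closed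
citable fact (e.g. `RationallyStandardTypeIff Φ B DivB True False P ↔ ¬ Hypotheses Φ B`);
fact-claimers and the named-fact debt counter skip it.  The closed re-binding is filed additively as
`RationallyStandardTypeIff'` once those constructions land. [cite: MochizukiFrdI2008, Thm. 5.2(iii) p.101] -/
def RationallyStandardTypeIff (IsOfRationallyStandardType IsOfRationalType : Prop)
    {CunTrBirat : Type (max u w)} (IsFrobeniusCompactIn : CunTrBirat → Prop) : Prop :=
  Hypotheses Φ B →
    (IsOfRationallyStandardType ↔
      (IsOfRationalType ∧ (data Φ B DivB).IsOfStandardType) ∧ ∃ Y : CunTrBirat, IsFrobeniusCompactIn Y)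

/-- **Thm. 5.2 (iii)**, second sentence — CLOSED re-binding of `RationallyStandardTypeIff` over seat
L1-t3's Def. 4.5 interface (ruling on RQ7-L1t2-F5): for `R : (data Φ B DivB).RSParams` (the
birationalization `C^birat`, the support predicate `Supp` of Def. 2.4 (i)(d), the operations of
`C^un-tr` and its birationalization `(C^un-tr)^birat`), "`C` is of rationally standard type
[`PreFrobenioidData.IsOfRationallyStandardType (data Φ B DivB) R`, Def. 4.5 (iii)] if and only if
(a) `C` is of rational [every object rational, Def. 4.5 (ii): `PreFrobenioidData.IsRational R.B R.Supp`]
and standard type; (b) `(C^un-tr)^birat` admits a Frobenius-compact object".  The content beyond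
Def. 4.5 (iii) is that (a), (b) force birational Frobenius-normalization (every object of a model
Frobenioid is birationally Frobenius-normalized, proof of Thm. 5.2 (iii), FrdI p. 103).  SCHEMA ONLY in
the data-interface `RSParams` (faithful to print when `R` is THE birationalization /
unit-trivialisation data of `C`, seat L1-t5 / ruling C5), exactly like seat L1-t3's Def. 4.5 (iii).
[cite: MochizukiFrdI2008, Thm. 5.2(iii) p.101] -/
def RationallyStandardTypeIff' (R : (data Φ B DivB).RSParams) : Prop :=
  Hypotheses Φ B →
    ((data Φ B DivB).IsOfRationallyStandardType R ↔
      ((∀ A : ModelFrobenioid Φ B DivB, PreFrobenioidData.IsRational R.B R.Supp A) ∧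
          (data Φ B DivB).IsOfStandardType) ∧
        ∃ Y : R.BU.Birat, R.BU.ops.IsFrobeniusCompact Y)

end ModelFrobenioid

end Literature.AlgebraicGeometry.Frobenioids
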